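import Summits.AtomisticToContinuum.Crystallization.Theorems.ChartedZeroExcessLayeredLatticeLiouvilleJ

/-!
# Charted zero excess ⟹ layered, lattice-Liouville chain — part K/10 (ASIDE, decomp-a2c lens-2 generation 26): WHERE THE «NO CORES» PIECE K SITS —
# F. John's small-strain uniqueness theorem, and its exact-core instance typed as `FinitePerturbationRigidity`

This file is an ASIDE to parts I/J (not in the cone of any column; banked context for the critic, the census and a future line on K
`CoreExclusion`).  It records the dictionary found after the g26 node was posted and types the one statement of it that the door currency
states cleanly.

DICTIONARY (continuum ↦ door sets).  F. John, *Uniqueness of non-linear elastic equilibrium for prescribed boundary displacements and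
sufficiently small strains*, CPAM 25 (1972) 617–634 (doi:10.1002/cpa.3160250505; extended to BMO-neighbourhoods and the mixed problem by
Spector–Spector, arXiv:2004.02368, §5 Cor. 5.4 / Rem. 5.6): about a stress-free reference with uniformly positive elasticity tensor there is an
L^∞-NEIGHBOURHOOD IN STRAIN SPACE containing at most one equilibrium with given boundary displacements; the proof is convexity of the energy
along segments inside the neighbourhood (the second variation stays positive throughout the tube).  Door sets live in such a tube BY HYPOTHESIS:
every two-shell environment is `θ`-affine-good (`θ = 1/16`) and the configuration is charted (perfect Barlow bond topology), so every local
strain lies in the clean window — a «core» (a localised finite-amplitude equilibrium distortion, the obstruction isolated by K in part J) is a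
SECOND equilibrium in John's tube with the same data at infinity.  Hence: (i) if the clean window `θ = 1/16` (with chart distortion `Λ = 2`)
lies inside the John radius of the Lennard-Jones lattice system — a CERTIFIABLE NUMERIC INEQUALITY («JOHN-RADIUS»: positivity of the LJ
lattice Hessian, modulo translations and the per-layer Γ-modes, at EVERY configuration of the `2θ`-tube, not only at the crystals as in
`CleanCrystalStability` / `LayeredCrystalStability`) — then compactly supported cores are excluded by John's argument verbatim (Nash ⟹ zero
forces ⟹ critical point for finitely supported variations; strict convexity along the segment), finite-energy cores by its ℓ²-version, and
the interior L² → L^∞ estimate K / the Campanato decay H_pert become PERTURBATIVE REGULARITY AT THE KINEMATIC OSCILLATION LEVEL (freezing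
around the chart's linearised operator with Cordes-type smallness `τ_kin · Lip(Hessian) ≪ λ_tube`): ATTACKABLE·XL, no new idea; (ii) if
not, genuinely non-perturbative clean equilibria may exist and K is where they would show.  So K's leaf tag is refined from IDEA-NEEDED to
«ATTACKABLE·XL CONDITIONAL ON JOHN-RADIUS · INSTRUMENTABLE» and the census ask JOHN-RADIUS precedes CORE-HUNT.  In-cell cousin: lens-3 g24's
`IsTubeConvex` / `TubeConvexW′` is the same monotonicity-on-a-tube mechanism on the interlayer-gap node (RDEF/PS), one level up in the tree.

TYPED HERE.  `FinitePerturbationRigidity θ` — the EXACT-CORE instance of «no cores», John's uniqueness at infinity in door currency: two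
`θ`-good door sets that coincide outside a ball coincide.  WEAKER than N in substance (N makes every door set exactly layered near every atom,
and an exactly layered configuration is determined by its restriction to the complement of a ball); does not imply K, H♭ or N (it speaks of
compact perturbations only); UNDECIDED · TRUE-type; ATTACKABLE via the discrete John argument GIVEN JOHN-RADIUS; its cheapest falsifier is a
clean Nash charted configuration pair differing on a finite set (CORE-HUNT with exact agreement outside the relaxed ball).  Antitone in `θ`.
-/

noncomputable section

open scoped BigOperators InnerProductSpace RealInnerProductSpace
open MeasureTheory Set Metric Filter Topology
open Summit.AtomisticToContinuum.Crystallization.Theorems.ChartedPlanarOrderRigidityDoor (E3 IsClean IsNash IsCharted VisibleGap PertRegime atomsIn)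
open Summit.AtomisticToContinuum.Crystallization.Theorems.ChartedPlanarOrderDensityDichotomy (μS IsSep nK nK_nonneg)
open Summit.AtomisticToContinuum.Crystallization.Theorems.ChartedPlanarOrderMesoCut (IsDoorSet NearHom LayeredHom EnvClose)
open Summit.AtomisticToContinuum.Crystallization.Theorems.OverbindingBudgetLiouvilleDictionary (NearHomBD)
open Summit.AtomisticToContinuum.Crystallization.Theorems.ChartedPlanarOrderDoorLayered
  (TwoPeriodic DoorPeriodic PeriodicBulkGapDoor gap_and_pert_1_50_of_periodic NearHomL2BD nearHomL2BD_mono nearHomBD_of_nearHomL2BD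
   sq_le_finsum_mem not_nearHomL2BD_singleton envClose_mono)
open Summit.AtomisticToContinuum.Crystallization.Theorems.ChartedPlanarOrderDoorLayeredOsc (IsTwoShellAffineGood DoorPeriodicOsc)
open Summit.AtomisticToContinuum.Crystallization.Theorems.ChartedPlanarOrderCleanScaleP
  (IsCleanP IsDoorSetP DoorPeriodicP isDoorSetP_mono doorPeriodic_of_doorPeriodicP isDoorSetP_one_iff doorPeriodicP_one_iff)

namespace Summit.AtomisticToContinuum.Crystallization.Theorems.ChartedZeroExcessLayeredLatticeLiouville

/-! ## §F.8  (ASIDE) The exact-core instance of K: finite-perturbation rigidity of door sets (John's uniqueness at infinity) -/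

/-- ★ **FPR(θ) «FinitePerturbationRigidity θ»** [ASIDE · support-type · UNDECIDED · TRUE-type · ATTACKABLE given JOHN-RADIUS · INSTRUMENTABLE (CORE-HUNT, exact
agreement outside the ball)]: two `θ`-good door sets (separated, clean, Nash, charted, containing the origin) that coincide outside some ball are EQUAL —
no compactly supported «core» can be inserted into a clean Nash charted configuration.  The door-currency form of F. John's small-strain uniqueness
theorem (CPAM 25 (1972) 617–634) with the boundary at infinity; the discrete John argument proves it once the clean window lies inside the John radius
of the LJ lattice system.  Not in the cone of any column (K `CoreExclusion` needs the finite-ENERGY version inside a compactness argument); filed so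
that the exact-core question has a name and a probe. -/
def FinitePerturbationRigidity (θ : ℝ) : Prop :=
  ∀ δ : ℝ, 0 < δ → ∀ S S' : Set E3, IsDoorSet δ S → IsDoorSet δ S' →
    (∀ q ∈ S, IsTwoShellAffineGood θ S q) → (∀ q ∈ S', IsTwoShellAffineGood θ S' q) →
    (∃ ρ : ℝ, ∀ x : E3, ρ ≤ ‖x‖ → (x ∈ S ↔ x ∈ S')) → S = S'

/-- FPR is antitone in the oscillation parameter: rigidity for `θ'`-good pairs gives it for `θ`-good pairs, `θ ≤ θ'`. -/
theorem FinitePerturbationRigidity.anti {θ θ' : ℝ} (hθ : θ ≤ θ') (h : FinitePerturbationRigidity θ') :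
    FinitePerturbationRigidity θ :=
  fun δ hδ S S' hS hS' hg hg' hagree =>
    h δ hδ S S' hS hS' (fun q hq => (hg q hq).mono hθ) (fun q hq => (hg' q hq).mono hθ) hagree

/-- sanity (the statement is not vacuous in the trivial direction): a door set agrees with itself outside every ball, and FPR returns `S = S`. -/
theorem FinitePerturbationRigidity.refl_case {θ : ℝ} (h : FinitePerturbationRigidity θ) {δ : ℝ} (hδ : 0 < δ) {S : Set E3}
    (hS : IsDoorSet δ S) (hg : ∀ q ∈ S, IsTwoShellAffineGood θ S q) : S = S :=
  h δ hδ S S hS hS hg hg ⟨0, fun _ _ => Iff.rfl⟩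

end Summit.AtomisticToContinuum.Crystallization.Theorems.ChartedZeroExcessLayeredLatticeLiouville

end
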